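import Literature.MathematicalPhysics.QuantumFieldTheory.Balaban1983to89.BlockAveragingSU2
import Literature.MathematicalPhysics.QuantumFieldTheory.Balaban1983to89.MatrixLog

/-!
# Bałaban's axiom (0.8) for the quaternionic projected mean on `SU(2)` [Balaban1987RG1]: the small-loop average `su2Mean`
# agrees with the arithmetic mean to second order at the identity (barycentre form, logarithmic form), is as close to `1`
# as the family, and is `2/(n(1 − δ²/2))`-Lipschitz in each of its `n` variables

Cell `pub-balaban`, T4 programme, row T4-D.L-SU2-08 (pv26 lineage; continuation of the tree modules `BlockAveraging` — the
printed block averaging (0.4) of [Balaban1987RG1] over an abstract small-loop average `ℰ : LoopAverage G` axiomatised by the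
paper's (0.5)–(0.7) — and `BlockAveragingSU2`, whose `su2Mean : LoopAverage SU(2)` (`su2Mean.E = SU2Mean.mean`, the
normalised Euclidean barycentre `mean W = (det Σ_j W_j)^{-1/2} Σ_j W_j`) is the cell's concrete measurable inhabitant on the
group of the summit statement).  The header of `BlockAveragingSU2` lists under NOT ENCODED: "(0.8) (the linearisation
`(1/i) log M({exp iA_j}) = n⁻¹ Σ A_j + …`; true for the projected mean but not proved here)".  This module proves it, in
quantitative form, for that inhabitant; nothing of the manuscripts is asserted.

CITATION HEADER (lean-in-tree rule 2026-08-18).  T. Bałaban, *Renormalization group approach to lattice gauge field theories.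
I. Generation of effective actions in a small field approximation and a coupling constant renormalization in four
dimensions*, Comm. Math. Phys. **109** (1987) 249–301 [Balaban1987RG1], p. 253, quoted from the page render
(`1987-cmp109-rg-I-small-field-p005-x4.png`; locus certified in the cell's READING rows C-pv26g2-3 / C-pv26g2-4): after
(0.5)–(0.7), "for a set {U_j} of elements close to the identity of the group, i.e. U_j = exp iA_j with A_j in a small
neighborhood of 0 in gᶜ, the average is close to the identity also, and
  (1/i) log M({exp iA_j}) = (1/n) Σ_{j=1}^{n} A_j + (higher order terms);   (0.8)
  if U_j ∈ G, then M({U_j}) ∈ G also.   (0.9)"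
and "The considerations and results of this, and previous papers, do not depend on any particular averaging operation used;
they are valid universally for all averages satisfying the above properties."  The logarithm is the series (21) p. 21 of
T. Bałaban, *Averaging operations for lattice gauge theories*, Comm. Math. Phys. **98** (1985) 17–51 [Balaban1985Averaging]
("log X = Σ_{n=1}^∞ ((−1)^{n+1}/n)(X − 1)^n. (21)", tree `MatrixLog.mlog`), for which "|X − 1| ≤ ½" gives
"|log X| ≤ 2|X − 1|", "|X − 1| ≤ 2|log X|" ((26)–(27) p. 22, tree `MatrixLog.norm_mlog_le_two_mul`,
`MatrixLog.norm_sub_one_le_two_mul_norm_mlog`).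

WHAT IS PROVED (all norms are `L²`-operator norms on `M₂(ℂ)`, `|ι| = n` the size of the family, `d_j = ‖W_j − 1‖ = dist1 W_j`):
* §1 Quaternion arithmetic of `q(W) = Σ_j W_j` (`SU2Mean.qsum`): `‖q‖² = det q` (`norm_qsum_sq`, the `C⋆`-identity with
  `q† q = det q · 1`), `‖q‖ = √det q` (`norm_qsum_eq_sqrt`), `Re tr q = 2n − Σ_j d_j²` (`trace_qsum_re_eq`, the chord formula
  `‖1 − U‖² = 2 − Re tr U` of the tree), `½ Re tr q ≤ ‖q‖` (`half_trace_re_le_norm_qsum`: the scalar part of a quaternion is at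
  most its norm), `‖q‖ ≤ n` (`norm_qsum_le_card`).
* §2 **(0.8), barycentre form**, with NO smallness hypothesis: `‖mean W − n⁻¹ Σ_j W_j‖ ≤ (2n)⁻¹ Σ_j d_j²`
  (`norm_mean_sub_bary_le`; the proof computes the left side as `1 − ‖q‖/n` off the exceptional set and bounds it by
  `½ Re tr q ≤ ‖q‖`) — the average agrees with the arithmetic mean of the group elements to SECOND order at the identity
  family; "the average is close to the identity also":
  `‖mean W − 1‖ ≤ n⁻¹ Σ_j d_j + (2n)⁻¹ Σ_j d_j²` always (`norm_mean_sub_one_le`), and the loss-free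
  `‖mean W − 1‖² ≤ n⁻¹ Σ_j d_j²` whenever `Re tr q(W) ≥ 0`, e.g. when every `d_j² ≤ 2` (`norm_mean_sub_one_sq_le`,
  `norm_mean_sub_one_le_of_forall_le`: `d_j ≤ δ` for all `j` ⇒ `‖mean W − 1‖ ≤ δ`).
* §3 **The per-variable modulus**: off the exceptional set `‖mean W − mean W′‖ ≤ 2 (det q(W))^{-1/2} ‖q(W) − q(W′)‖`
  for EVERY second family `W′` (`norm_mean_sub_mean_le`), `‖q(W) − q(W′)‖ ≤ Σ_j ‖W_j − W′_j‖` (`norm_qsum_sub_qsum_le`); hence on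
  families with `d_j ≤ δ ≤ 1`: `‖mean W − mean W′‖ ≤ (2 / (n(1 − δ²/2))) Σ_j ‖W_j − W′_j‖ ≤ (4/n) Σ_j ‖W_j − W′_j‖`
  (`norm_mean_sub_mean_le_of_small`, `norm_mean_sub_mean_le_four_div`) — each of the `n` loop variables enters the mean with
  weight `≍ 1/n`.
* §4 **(0.8), logarithmic form** with the series logarithm (21): the second-order Taylor remainder of (21),
  `‖log X − (X − 1)‖ ≤ ‖X − 1‖²/(2(1 − ‖X − 1‖))` for `‖X − 1‖ < 1` and `≤ ‖X − 1‖²` for `‖X − 1‖ ≤ ½`, in any complete normed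
  `ℂ`-algebra (two lemmas added to the namespace `MatrixLog` of the tree module of that name, which is not edited:
  `MatrixLog.norm_mlog_sub_sub_one_le`, `MatrixLog.norm_mlog_sub_sub_one_le_sq`); and then, for families with all `d_j ≤ ½`,
  `‖log (mean W) − n⁻¹ Σ_j log W_j‖ ≤ (5/2) n⁻¹ Σ_j d_j²` (`norm_mlog_mean_sub_le`) and, in the variables `A_j = (1/i) log W_j`
  of (0.8) (so that `W_j = e^{iA_j}`, `MatrixLog.exp_mlog`), `‖(1/i) log (mean W) − n⁻¹ Σ_j A_j‖ ≤ 10 · n⁻¹ Σ_j ‖A_j‖²`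
  (`norm_Iinv_mlog_mean_sub_le`): the "higher order terms" of (0.8) are quadratically small, with explicit constants.
* §5 The same statements for the `LoopAverage` instance `su2Mean` on `Fin (k+1)`-families in the vocabulary `dist1`
  (`su2Mean_norm_sub_bary_le`, `su2Mean_dist1_le`, `su2Mean_mlog_le`, `su2Mean_lipschitz`).
(0.9) is type-level in the tree (`SU2Mean.projMat_qsum_mem`: the mean of an `SU(2)`-family lies in `SU(2)`) and is cited, not
restated.

NOT ENCODED: `Gᶜ`-valuedness of `M` and analyticity on `SL(2, ℂ)`-families (the complexified formula `q ↦ (det q)^{-1/2} q`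
is not studied here); the identification of the series logarithm (21) with the principal logarithm (23) (tree `MatrixLog`
audit remark (ii)); Federbush's (0.10).  DIVERGENCE (cell row D-pv26g3.1): (0.8) is printed in exponential coordinates
`U_j = exp iA_j`; §2 states it in the chart `W ↦ W − 1` and §4 in the chart `W ↦ log W`, which agree to first order at `1`
((26)–(27)); the constants `5/2`, `10`, `4` are this file's, not the paper's.  VALUE: kernel certificate that the cell's
`SU(2)` inhabitant has the printed property (0.8) — with (0.5)–(0.7), (0.9) and measurability from `BlockAveragingSU2` the
list (0.5)–(0.9) is now checked for it except analyticity on `Gᶜ`; NOT an estimate of the programme, NOT summit progress.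
-/

noncomputable section

open scoped Matrix.Norms.L2Operator ComplexOrder BigOperators
open NormedSpace

namespace Literature.MathematicalPhysics.QuantumFieldTheory.Balaban1983to89

open Literature.Computability.QuantumComplexity (adjugate_fin_two_eq_trace_smul_sub norm_one_sub_coe_sq)

/-! ## 4a. The second-order remainder of the logarithmic series (21) -/

namespace MatrixLog

section Series

variable {𝔄 : Type*} [NormedRing 𝔄] [NormedAlgebra ℂ 𝔄] [CompleteSpace 𝔄]

open Literature.Analysis.Complex (logSeriesCoeff norm_logSeriesCoeff_smul_pow_le)

/-- The second-order Taylor remainder of (21): `‖log X − (X − 1)‖ ≤ ‖X − 1‖² / (2(1 − ‖X − 1‖))` for `‖X − 1‖ < 1`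
(`log X − (X − 1) = Σ_{n ≥ 2} ((−1)^{n+1}/n)(X − 1)^n` and `1/n ≤ ½` there). [cite: Balaban1985Averaging, (21) p.21] -/
theorem norm_mlog_sub_sub_one_le {X : 𝔄} (hX : ‖X - 1‖ < 1) :
    ‖mlog X - (X - 1)‖ ≤ ‖X - 1‖ ^ 2 / (2 * (1 - ‖X - 1‖)) := by
  set t : ℝ := ‖X - 1‖ with ht
  have ht0 : 0 ≤ t := norm_nonneg _
  have hser : HasSum (fun n : ℕ => logSeriesCoeff (n + 2) • (X - 1) ^ (n + 2)) (mlog X - (X - 1)) := by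
    have h0 : HasSum (fun n : ℕ => logSeriesCoeff n • (X - 1) ^ n) (mlog X) := hasSum_mlog hX
    have h := (hasSum_nat_add_iff' 2).mpr h0
    have e : (∑ i ∈ Finset.range 2, logSeriesCoeff i • (X - 1) ^ i) = X - 1 := by
      simp [Finset.sum_range_succ, Literature.Analysis.Complex.logSeriesCoeff]
    rwa [e] at h
  have hreal : HasSum (fun n : ℕ => 1 / 2 * (t ^ 2 * t ^ n)) (1 / 2 * (t ^ 2 * (1 - t)⁻¹)) :=
    ((hasSum_geometric_of_lt_one ht0 hX).mul_left (t ^ 2)).mul_left (1 / 2)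
  have hle : ‖mlog X - (X - 1)‖ ≤ 1 / 2 * (t ^ 2 * (1 - t)⁻¹) := by
    refine hser.norm_le_of_bounded hreal fun n => ?_
    have hc : ‖logSeriesCoeff (n + 2)‖ = 1 / ((n : ℝ) + 1 + 1) := by
      rw [show n + 2 = n + 1 + 1 from rfl, norm_logSeriesCoeff_succ]
      push_cast
      ring
    have hc2 : 1 / ((n : ℝ) + 1 + 1) ≤ 1 / 2 :=
      one_div_le_one_div_of_le two_pos (by linarith [(n.cast_nonneg : (0 : ℝ) ≤ n)])
    calc ‖logSeriesCoeff (n + 2) • (X - 1) ^ (n + 2)‖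
          ≤ ‖logSeriesCoeff (n + 2)‖ * ‖(X - 1) ^ (n + 2)‖ := norm_smul_le _ _
      _ ≤ 1 / 2 * t ^ (n + 2) := by
          rw [hc]
          exact mul_le_mul hc2 (norm_pow_le' (X - 1) (Nat.succ_pos _)) (norm_nonneg _) (by norm_num)
      _ = 1 / 2 * (t ^ 2 * t ^ n) := by ring
  calc ‖mlog X - (X - 1)‖ ≤ 1 / 2 * (t ^ 2 * (1 - t)⁻¹) := hle
    _ = t ^ 2 / (2 * (1 - t)) := by
        field_simp

/-- For `‖X − 1‖ ≤ ½` the remainder is at most `‖X − 1‖²`. [cite: Balaban1985Averaging, (21) p.21] -/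
theorem norm_mlog_sub_sub_one_le_sq {X : 𝔄} (hX : ‖X - 1‖ ≤ 1 / 2) : ‖mlog X - (X - 1)‖ ≤ ‖X - 1‖ ^ 2 := by
  have hX1 : ‖X - 1‖ < 1 := hX.trans_lt (by norm_num)
  refine (norm_mlog_sub_sub_one_le hX1).trans ?_
  rw [div_le_iff₀ (by linarith)]
  nlinarith [sq_nonneg ‖X - 1‖]

end Series

end MatrixLog

namespace SU2Mean

variable {ι : Type*} [Fintype ι]

/-! ## 1. Quaternion arithmetic of `q(W) = Σ_j W_j` -/

/-- `‖q(W)‖² = Re det q(W)` — the `C⋆`-identity applied to `q† q = det q · 1`. [folklore] -/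
theorem norm_qsum_sq (W : ι → Matrix.specialUnitaryGroup (Fin 2) ℂ) : ‖qsum W‖ ^ 2 = ((qsum W).det).re := by
  have hcs : ‖star (qsum W) * qsum W‖ = ‖qsum W‖ * ‖qsum W‖ := CStarRing.norm_star_mul_self
  rw [star_mul_qsum, det_qsum_eq_ofReal W, norm_smul, CStarRing.norm_one, mul_one, Complex.norm_real,
    Real.norm_of_nonneg (det_qsum_re_nonneg W)] at hcs
  rw [sq, ← hcs]

/-- `‖q(W)‖ = √(Re det q(W))`. [folklore] -/
theorem norm_qsum_eq_sqrt (W : ι → Matrix.specialUnitaryGroup (Fin 2) ℂ) : ‖qsum W‖ = Real.sqrt ((qsum W).det).re := by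
  rw [← norm_qsum_sq, Real.sqrt_sq (norm_nonneg _)]

/-- `Re tr q(W) = Σ_j Re tr W_j = 2|ι| − Σ_j ‖W_j − 1‖²` (chord formula `‖1 − U‖² = 2 − Re tr U` in `SU(2)`). [folklore] -/
theorem trace_qsum_re_eq (W : ι → Matrix.specialUnitaryGroup (Fin 2) ℂ) :
    ((qsum W).trace).re = 2 * Fintype.card ι - ∑ j, ‖(W j : Matrix (Fin 2) (Fin 2) ℂ) - 1‖ ^ 2 := by
  have h : ((qsum W).trace).re = ∑ j, (((W j : Matrix (Fin 2) (Fin 2) ℂ)).trace).re := by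
    unfold qsum
    rw [Matrix.trace_sum, Complex.re_sum]
  have hj : ∀ j, (((W j : Matrix (Fin 2) (Fin 2) ℂ)).trace).re = 2 - ‖(W j : Matrix (Fin 2) (Fin 2) ℂ) - 1‖ ^ 2 := fun j => by
    rw [norm_sub_rev, norm_one_sub_coe_sq]; ring
  rw [h, Finset.sum_congr rfl fun j _ => hj j, Finset.sum_sub_distrib, Finset.sum_const, Finset.card_univ, nsmul_eq_mul]
  ring

/-- The scalar part of a quaternion is at most its norm: `½ Re tr q(W) ≤ ‖q(W)‖`. [folklore] -/
theorem half_trace_re_le_norm_qsum (W : ι → Matrix.specialUnitaryGroup (Fin 2) ℂ) :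
    ((qsum W).trace).re / 2 ≤ ‖qsum W‖ := by
  set q : Matrix (Fin 2) (Fin 2) ℂ := qsum W with hq
  -- `q + q† = tr q · 1`, so `Re tr q = 2 Re q₀₀`
  have hadd : q + star q = q.trace • (1 : Matrix (Fin 2) (Fin 2) ℂ) := by
    rw [hq, star_qsum, adjugate_fin_two_eq_trace_smul_sub]; abel
  have h00 : q 0 0 + star (q 0 0) = q.trace := by
    have h := congrFun (congrFun hadd 0) 0
    rw [Matrix.add_apply, Matrix.star_apply, Matrix.smul_apply, Matrix.one_apply_eq, smul_eq_mul, mul_one] at h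
    exact h
  have hre : (q.trace).re = 2 * (q 0 0).re := by
    rw [← h00, Complex.add_re, Complex.star_def, Complex.conj_re]; ring
  -- `det q = |q₀₀|² + |q₀₁|² ≥ (Re q₀₀)²`
  have hdet : (q.det).re = Complex.normSq (q 0 0) + Complex.normSq (q 0 1) := by
    have h := congrFun (congrFun (qsum_mul_star W) 0) 0
    rw [Matrix.mul_apply, Matrix.smul_apply, Matrix.one_apply_eq, smul_eq_mul, mul_one] at h
    rw [← hq] at h
    rw [← h, Fin.sum_univ_two, Matrix.star_apply, Matrix.star_apply, Complex.star_def,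
      Complex.mul_conj, Complex.mul_conj, Complex.add_re, Complex.ofReal_re, Complex.ofReal_re]
  have hsq : ((q.trace).re / 2) ^ 2 ≤ (q.det).re := by
    rw [hre, hdet, Complex.normSq_apply, Complex.normSq_apply]
    nlinarith [sq_nonneg (q 0 0).im, sq_nonneg (q 0 1).re, sq_nonneg (q 0 1).im]
  calc (q.trace).re / 2 ≤ |(q.trace).re / 2| := le_abs_self _
    _ ≤ Real.sqrt (q.det).re := Real.abs_le_sqrt hsq
    _ = ‖q‖ := (norm_qsum_eq_sqrt W).symm

/-- `‖q(W)‖ ≤ |ι|` (each `‖W_j‖ ≤ 1`). [folklore] -/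
theorem norm_qsum_le_card (W : ι → Matrix.specialUnitaryGroup (Fin 2) ℂ) : ‖qsum W‖ ≤ Fintype.card ι := by
  unfold qsum
  calc ‖∑ j, (W j : Matrix (Fin 2) (Fin 2) ℂ)‖ ≤ ∑ j, ‖(W j : Matrix (Fin 2) (Fin 2) ℂ)‖ := norm_sum_le _ _
    _ ≤ ∑ _j : ι, (1 : ℝ) := Finset.sum_le_sum fun j _ =>
        Literature.Computability.QuantumComplexity.SolovayKitaev.norm_coe_le_one (W j)
    _ = Fintype.card ι := by rw [Finset.sum_const, Finset.card_univ, nsmul_eq_mul, mul_one]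

/-- `‖q(W) − q(W′)‖ ≤ Σ_j ‖W_j − W′_j‖`. [folklore] -/
theorem norm_qsum_sub_qsum_le (W W' : ι → Matrix.specialUnitaryGroup (Fin 2) ℂ) :
    ‖qsum W - qsum W'‖ ≤ ∑ j, ‖(W j : Matrix (Fin 2) (Fin 2) ℂ) - (W' j : Matrix (Fin 2) (Fin 2) ℂ)‖ := by
  unfold qsum
  rw [← Finset.sum_sub_distrib]
  exact norm_sum_le _ _

/-- `n⁻¹ q(W) − 1 = n⁻¹ Σ_j (W_j − 1)` for a nonempty family. [folklore] -/
theorem inv_card_smul_qsum_sub_one [Nonempty ι] (W : ι → Matrix.specialUnitaryGroup (Fin 2) ℂ) :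
    ((Fintype.card ι : ℂ))⁻¹ • qsum W - 1 = ((Fintype.card ι : ℂ))⁻¹ • ∑ j, ((W j : Matrix (Fin 2) (Fin 2) ℂ) - 1) := by
  have hn : (Fintype.card ι : ℂ) ≠ 0 := Nat.cast_ne_zero.2 Fintype.card_ne_zero
  unfold qsum
  rw [Finset.sum_sub_distrib, Finset.sum_const, Finset.card_univ, ← Nat.cast_smul_eq_nsmul ℂ, smul_sub, smul_smul,
    inv_mul_cancel₀ hn, one_smul]

/-! ## 2. (0.8), barycentre form, and "the average is close to the identity also" -/

/-- **(0.8), barycentre form** (no smallness hypothesis): `‖mean W − n⁻¹ Σ_j W_j‖ ≤ (2n)⁻¹ Σ_j ‖W_j − 1‖²` — the projected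
mean agrees with the arithmetic mean to second order at the identity family. [cite: Balaban1987RG1, (0.8) p.253] -/
theorem norm_mean_sub_bary_le [Nonempty ι] (W : ι → Matrix.specialUnitaryGroup (Fin 2) ℂ) :
    ‖(mean W : Matrix (Fin 2) (Fin 2) ℂ) - ((Fintype.card ι : ℂ))⁻¹ • qsum W‖ ≤
      (2 * (Fintype.card ι : ℝ))⁻¹ * ∑ j, ‖(W j : Matrix (Fin 2) (Fin 2) ℂ) - 1‖ ^ 2 := by
  have hn : (0 : ℝ) < Fintype.card ι := Nat.cast_pos.2 Fintype.card_pos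
  have hsum : ∑ j, ‖(W j : Matrix (Fin 2) (Fin 2) ℂ) - 1‖ ^ 2 = 2 * Fintype.card ι - ((qsum W).trace).re := by
    rw [trace_qsum_re_eq]; ring
  have htr := half_trace_re_le_norm_qsum W
  have hqn := norm_qsum_le_card W
  by_cases h0 : (qsum W).det = 0
  · -- exceptional branch: `q = 0`, `mean = 1`, both sides equal `1`
    have hq0 : qsum W = 0 := qsum_eq_zero_of_det_eq_zero W h0
    have htr0 : ((qsum W).trace).re = 0 := by rw [hq0, Matrix.trace_zero, Complex.zero_re]
    rw [coe_mean, projMat_of_eq h0, hq0, smul_zero, sub_zero, hsum, htr0, sub_zero,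
      inv_mul_cancel₀ (show (2 * (Fintype.card ι : ℝ)) ≠ 0 by positivity)]
    -- `‖1‖ = 1`
    exact le_of_eq CStarRing.norm_one
  · have hD : 0 < ((qsum W).det).re := det_qsum_re_pos W h0
    set s : ℝ := Real.sqrt ((qsum W).det).re with hs
    have hs0 : 0 < s := Real.sqrt_pos.2 hD
    have hqs : ‖qsum W‖ = s := norm_qsum_eq_sqrt W
    have e : (mean W : Matrix (Fin 2) (Fin 2) ℂ) - ((Fintype.card ι : ℂ))⁻¹ • qsum W =
        (((s⁻¹ - (Fintype.card ι : ℝ)⁻¹ : ℝ)) : ℂ) • qsum W := by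
      rw [coe_mean, projMat_of_ne h0, ← hs, Complex.ofReal_sub, sub_smul, Complex.ofReal_inv, Complex.ofReal_inv,
        Complex.ofReal_natCast]
    rw [e, norm_smul, Complex.norm_real, Real.norm_eq_abs, hqs]
    have hid : |s⁻¹ - (Fintype.card ι : ℝ)⁻¹| * s = |1 - s / Fintype.card ι| := by
      rw [← abs_of_pos hs0, ← abs_mul, abs_of_pos hs0]
      congr 1
      field_simp
    rw [hid, abs_of_nonneg (by rw [sub_nonneg, div_le_one hn]; exact hqs ▸ hqn), hsum]
    rw [show (2 * (Fintype.card ι : ℝ))⁻¹ * (2 * Fintype.card ι - ((qsum W).trace).re) =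
      1 - ((qsum W).trace).re / 2 / Fintype.card ι by field_simp]
    have : ((qsum W).trace).re / 2 / Fintype.card ι ≤ s / Fintype.card ι :=
      div_le_div_of_nonneg_right (hqs ▸ htr) hn.le
    linarith

/-- "the average is close to the identity also", unconditionally: `‖mean W − 1‖ ≤ n⁻¹ Σ_j ‖W_j − 1‖ + (2n)⁻¹ Σ_j ‖W_j − 1‖²`.
[cite: Balaban1987RG1, (0.8) p.253] -/
theorem norm_mean_sub_one_le [Nonempty ι] (W : ι → Matrix.specialUnitaryGroup (Fin 2) ℂ) :
    ‖(mean W : Matrix (Fin 2) (Fin 2) ℂ) - 1‖ ≤ (Fintype.card ι : ℝ)⁻¹ * ∑ j, ‖(W j : Matrix (Fin 2) (Fin 2) ℂ) - 1‖ +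
      (2 * (Fintype.card ι : ℝ))⁻¹ * ∑ j, ‖(W j : Matrix (Fin 2) (Fin 2) ℂ) - 1‖ ^ 2 := by
  have h1 := norm_mean_sub_bary_le W
  have h2 : ‖((Fintype.card ι : ℂ))⁻¹ • qsum W - 1‖ ≤
      (Fintype.card ι : ℝ)⁻¹ * ∑ j, ‖(W j : Matrix (Fin 2) (Fin 2) ℂ) - 1‖ := by
    rw [inv_card_smul_qsum_sub_one, norm_smul, norm_inv, Complex.norm_natCast]
    exact mul_le_mul_of_nonneg_left (norm_sum_le _ _) (by positivity)
  calc ‖(mean W : Matrix (Fin 2) (Fin 2) ℂ) - 1‖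
        ≤ ‖(mean W : Matrix (Fin 2) (Fin 2) ℂ) - ((Fintype.card ι : ℂ))⁻¹ • qsum W‖ + ‖((Fintype.card ι : ℂ))⁻¹ • qsum W - 1‖ :=
        norm_sub_le_norm_sub_add_norm_sub _ _ _
    _ ≤ _ := by linarith

/-- "the average is close to the identity also", loss-free: if `Re tr q(W) ≥ 0` then `‖mean W − 1‖² ≤ n⁻¹ Σ_j ‖W_j − 1‖²`
(the mean square chord distance of the family). [cite: Balaban1987RG1, (0.8) p.253] -/
theorem norm_mean_sub_one_sq_le [Nonempty ι] (W : ι → Matrix.specialUnitaryGroup (Fin 2) ℂ) (h : 0 ≤ ((qsum W).trace).re) :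
    ‖(mean W : Matrix (Fin 2) (Fin 2) ℂ) - 1‖ ^ 2 ≤
      (Fintype.card ι : ℝ)⁻¹ * ∑ j, ‖(W j : Matrix (Fin 2) (Fin 2) ℂ) - 1‖ ^ 2 := by
  have hn : (0 : ℝ) < Fintype.card ι := Nat.cast_pos.2 Fintype.card_pos
  have hsum : ∑ j, ‖(W j : Matrix (Fin 2) (Fin 2) ℂ) - 1‖ ^ 2 = 2 * Fintype.card ι - ((qsum W).trace).re := by
    rw [trace_qsum_re_eq]; ring
  by_cases h0 : (qsum W).det = 0
  · rw [coe_mean, projMat_of_eq h0, sub_self, norm_zero, sq, mul_zero]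
    exact mul_nonneg (by positivity) (Finset.sum_nonneg fun j _ => sq_nonneg _)
  · have hD : 0 < ((qsum W).det).re := det_qsum_re_pos W h0
    set s : ℝ := Real.sqrt ((qsum W).det).re with hs
    have hs0 : 0 < s := Real.sqrt_pos.2 hD
    have hqs : ‖qsum W‖ = s := norm_qsum_eq_sqrt W
    have hsn : s ≤ Fintype.card ι := hqs ▸ norm_qsum_le_card W
    -- chord formula for the mean, which lies in `SU(2)`
    have hch : ‖(mean W : Matrix (Fin 2) (Fin 2) ℂ) - 1‖ ^ 2 = 2 - (((mean W : Matrix (Fin 2) (Fin 2) ℂ)).trace).re := by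
      rw [norm_sub_rev, norm_one_sub_coe_sq]
    have htrm : (((mean W : Matrix (Fin 2) (Fin 2) ℂ)).trace).re = s⁻¹ * ((qsum W).trace).re := by
      rw [coe_mean, projMat_of_ne h0, ← hs, Matrix.trace_smul, smul_eq_mul, Complex.re_ofReal_mul]
    rw [hch, htrm, hsum]
    rw [show (Fintype.card ι : ℝ)⁻¹ * (2 * Fintype.card ι - ((qsum W).trace).re) =
      2 - ((qsum W).trace).re / Fintype.card ι by field_simp]
    have : ((qsum W).trace).re / Fintype.card ι ≤ s⁻¹ * ((qsum W).trace).re := by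
      rw [← div_eq_inv_mul]
      exact div_le_div_of_nonneg_left h hs0 hsn
    linarith

/-- Hence: if every member of a nonempty family is within `δ` of `1`, `δ² ≤ 2`, then so is the mean: `‖mean W − 1‖ ≤ δ`.
[cite: Balaban1987RG1, (0.8) p.253] -/
theorem norm_mean_sub_one_le_of_forall_le [Nonempty ι] (W : ι → Matrix.specialUnitaryGroup (Fin 2) ℂ) {δ : ℝ}
    (hW : ∀ j, ‖(W j : Matrix (Fin 2) (Fin 2) ℂ) - 1‖ ≤ δ) (hδ : δ ^ 2 ≤ 2) :
    ‖(mean W : Matrix (Fin 2) (Fin 2) ℂ) - 1‖ ≤ δ := by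
  have hn : (0 : ℝ) < Fintype.card ι := Nat.cast_pos.2 Fintype.card_pos
  have hδ0 : 0 ≤ δ := (norm_nonneg _).trans (hW (Classical.arbitrary ι))
  have hsq : ∀ j, ‖(W j : Matrix (Fin 2) (Fin 2) ℂ) - 1‖ ^ 2 ≤ δ ^ 2 := fun j => pow_le_pow_left₀ (norm_nonneg _) (hW j) 2
  have hS : ∑ j, ‖(W j : Matrix (Fin 2) (Fin 2) ℂ) - 1‖ ^ 2 ≤ Fintype.card ι * δ ^ 2 := by
    calc ∑ j, ‖(W j : Matrix (Fin 2) (Fin 2) ℂ) - 1‖ ^ 2 ≤ ∑ _j : ι, δ ^ 2 := Finset.sum_le_sum fun j _ => hsq j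
      _ = Fintype.card ι * δ ^ 2 := by rw [Finset.sum_const, Finset.card_univ, nsmul_eq_mul]
  have htr : 0 ≤ ((qsum W).trace).re := by
    rw [trace_qsum_re_eq]
    have : ∑ j, ‖(W j : Matrix (Fin 2) (Fin 2) ℂ) - 1‖ ^ 2 ≤ Fintype.card ι * 2 := by
      calc ∑ j, ‖(W j : Matrix (Fin 2) (Fin 2) ℂ) - 1‖ ^ 2 ≤ ∑ _j : ι, (2 : ℝ) := Finset.sum_le_sum fun j _ => (hsq j).trans hδ
        _ = Fintype.card ι * 2 := by rw [Finset.sum_const, Finset.card_univ, nsmul_eq_mul]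
    linarith
  have h := norm_mean_sub_one_sq_le W htr
  have h2 : ‖(mean W : Matrix (Fin 2) (Fin 2) ℂ) - 1‖ ^ 2 ≤ δ ^ 2 := by
    refine h.trans ?_
    rw [inv_mul_le_iff₀ hn]
    exact hS
  exact (pow_le_pow_iff_left₀ (norm_nonneg _) hδ0 two_ne_zero).1 h2

/-! ## 3. The per-variable Lipschitz modulus -/

/-- `‖mean W‖ ≤ 1`. [folklore] -/
theorem norm_coe_mean_le_one (W : ι → Matrix.specialUnitaryGroup (Fin 2) ℂ) : ‖(mean W : Matrix (Fin 2) (Fin 2) ℂ)‖ ≤ 1 :=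
  Literature.Computability.QuantumComplexity.SolovayKitaev.norm_coe_le_one (mean W)

/-- **The modulus**: off the exceptional set, `‖mean W − mean W′‖ ≤ 2 (Re det q(W))^{-1/2} ‖q(W) − q(W′)‖` for every `W′`.
[folklore] -/
theorem norm_mean_sub_mean_le (W W' : ι → Matrix.specialUnitaryGroup (Fin 2) ℂ) (hW : (qsum W).det ≠ 0) :
    ‖(mean W : Matrix (Fin 2) (Fin 2) ℂ) - (mean W' : Matrix (Fin 2) (Fin 2) ℂ)‖ ≤
      2 * (Real.sqrt ((qsum W).det).re)⁻¹ * ‖qsum W - qsum W'‖ := by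
  have hD : 0 < ((qsum W).det).re := det_qsum_re_pos W hW
  set s : ℝ := Real.sqrt ((qsum W).det).re with hs
  have hs0 : 0 < s := Real.sqrt_pos.2 hD
  have hqs : ‖qsum W‖ = s := norm_qsum_eq_sqrt W
  by_cases h0 : (qsum W').det = 0
  · -- `q(W′) = 0`, `mean W′ = 1`: the left side is at most `2`, the right side equals `2`
    have hq0 : qsum W' = 0 := qsum_eq_zero_of_det_eq_zero W' h0
    rw [(Subtype.ext (by rw [coe_mean, projMat_of_eq h0]; rfl) : mean W' = 1), hq0, sub_zero, hqs, mul_assoc,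
      inv_mul_cancel₀ hs0.ne', mul_one]
    calc ‖(mean W : Matrix (Fin 2) (Fin 2) ℂ) - ((1 : Matrix.specialUnitaryGroup (Fin 2) ℂ) : Matrix (Fin 2) (Fin 2) ℂ)‖
          ≤ ‖(mean W : Matrix (Fin 2) (Fin 2) ℂ)‖ + ‖((1 : Matrix.specialUnitaryGroup (Fin 2) ℂ) : Matrix (Fin 2) (Fin 2) ℂ)‖ :=
          norm_sub_le _ _
      _ ≤ 1 + 1 := add_le_add (norm_coe_mean_le_one W) (by
          rw [show ((1 : Matrix.specialUnitaryGroup (Fin 2) ℂ) : Matrix (Fin 2) (Fin 2) ℂ) = 1 from rfl]; exact le_of_eq CStarRing.norm_one)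
      _ = 2 := by norm_num
  · have hD' : 0 < ((qsum W').det).re := det_qsum_re_pos W' h0
    set s' : ℝ := Real.sqrt ((qsum W').det).re with hs'
    have hs0' : 0 < s' := Real.sqrt_pos.2 hD'
    have hqs' : ‖qsum W'‖ = s' := norm_qsum_eq_sqrt W'
    have e : (mean W : Matrix (Fin 2) (Fin 2) ℂ) - (mean W' : Matrix (Fin 2) (Fin 2) ℂ) =
        ((s⁻¹ : ℝ) : ℂ) • (qsum W - qsum W') + (((s⁻¹ - s'⁻¹ : ℝ)) : ℂ) • qsum W' := by
      rw [coe_mean, coe_mean, projMat_of_ne hW, projMat_of_ne h0, ← hs, ← hs', smul_sub, Complex.ofReal_sub, sub_smul]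
      abel
    have h1 : ‖((s⁻¹ : ℝ) : ℂ) • (qsum W - qsum W')‖ = s⁻¹ * ‖qsum W - qsum W'‖ := by
      rw [norm_smul, Complex.norm_real, Real.norm_of_nonneg (inv_nonneg.2 hs0.le)]
    have h2 : ‖(((s⁻¹ - s'⁻¹ : ℝ)) : ℂ) • qsum W'‖ = s⁻¹ * |s' - s| := by
      rw [norm_smul, Complex.norm_real, Real.norm_eq_abs, hqs']
      rw [show s⁻¹ - s'⁻¹ = s⁻¹ * ((s' - s) * s'⁻¹) by field_simp, abs_mul, abs_of_pos (inv_pos.2 hs0), abs_mul,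
        abs_of_pos (inv_pos.2 hs0'), mul_assoc, mul_assoc, inv_mul_cancel₀ hs0'.ne', mul_one]
    have h3 : |s' - s| ≤ ‖qsum W - qsum W'‖ := by
      rw [← hqs, ← hqs', abs_sub_comm]
      exact abs_norm_sub_norm_le _ _
    calc ‖(mean W : Matrix (Fin 2) (Fin 2) ℂ) - (mean W' : Matrix (Fin 2) (Fin 2) ℂ)‖
          ≤ ‖((s⁻¹ : ℝ) : ℂ) • (qsum W - qsum W')‖ + ‖(((s⁻¹ - s'⁻¹ : ℝ)) : ℂ) • qsum W'‖ := by
          rw [e]; exact norm_add_le _ _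
      _ = s⁻¹ * ‖qsum W - qsum W'‖ + s⁻¹ * |s' - s| := by rw [h1, h2]
      _ ≤ s⁻¹ * ‖qsum W - qsum W'‖ + s⁻¹ * ‖qsum W - qsum W'‖ :=
          add_le_add le_rfl (mul_le_mul_of_nonneg_left h3 (inv_nonneg.2 hs0.le))
      _ = 2 * s⁻¹ * ‖qsum W - qsum W'‖ := by ring

/-- If all `‖W_j − 1‖ ≤ δ` then `(Re det q(W))^{1/2} ≥ n (1 − δ²/2)`. [folklore] -/
theorem card_mul_le_sqrt_det (W : ι → Matrix.specialUnitaryGroup (Fin 2) ℂ) {δ : ℝ}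
    (hW : ∀ j, ‖(W j : Matrix (Fin 2) (Fin 2) ℂ) - 1‖ ≤ δ) :
    Fintype.card ι * (1 - δ ^ 2 / 2) ≤ Real.sqrt ((qsum W).det).re := by
  have hsq : ∀ j, ‖(W j : Matrix (Fin 2) (Fin 2) ℂ) - 1‖ ^ 2 ≤ δ ^ 2 := fun j => pow_le_pow_left₀ (norm_nonneg _) (hW j) 2
  have hS : ∑ j, ‖(W j : Matrix (Fin 2) (Fin 2) ℂ) - 1‖ ^ 2 ≤ Fintype.card ι * δ ^ 2 := by
    calc ∑ j, ‖(W j : Matrix (Fin 2) (Fin 2) ℂ) - 1‖ ^ 2 ≤ ∑ _j : ι, δ ^ 2 := Finset.sum_le_sum fun j _ => hsq j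
      _ = Fintype.card ι * δ ^ 2 := by rw [Finset.sum_const, Finset.card_univ, nsmul_eq_mul]
  have h := half_trace_re_le_norm_qsum W
  rw [norm_qsum_eq_sqrt, trace_qsum_re_eq] at h
  linarith

/-- **The modulus on small families**: if `‖W_j − 1‖ ≤ δ ≤ 1` for all `j` (nonempty family) then for EVERY `W′`
`‖mean W − mean W′‖ ≤ (2 / (n (1 − δ²/2))) Σ_j ‖W_j − W′_j‖`. [folklore] -/
theorem norm_mean_sub_mean_le_of_small [Nonempty ι] (W W' : ι → Matrix.specialUnitaryGroup (Fin 2) ℂ) {δ : ℝ}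
    (hW : ∀ j, ‖(W j : Matrix (Fin 2) (Fin 2) ℂ) - 1‖ ≤ δ) (hδ : δ ≤ 1) :
    ‖(mean W : Matrix (Fin 2) (Fin 2) ℂ) - (mean W' : Matrix (Fin 2) (Fin 2) ℂ)‖ ≤
      2 / (Fintype.card ι * (1 - δ ^ 2 / 2)) * ∑ j, ‖(W j : Matrix (Fin 2) (Fin 2) ℂ) - (W' j : Matrix (Fin 2) (Fin 2) ℂ)‖ := by
  have hn : (0 : ℝ) < Fintype.card ι := Nat.cast_pos.2 Fintype.card_pos
  have hδ0 : 0 ≤ δ := (norm_nonneg _).trans (hW (Classical.arbitrary ι))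
  have hlow : 0 < Fintype.card ι * (1 - δ ^ 2 / 2) := mul_pos hn (by nlinarith)
  have hs := card_mul_le_sqrt_det W hW
  have hs0 : 0 < Real.sqrt ((qsum W).det).re := hlow.trans_le hs
  have hdet : (qsum W).det ≠ 0 := fun h0 => by
    rw [h0, Complex.zero_re, Real.sqrt_zero] at hs0
    exact lt_irrefl _ hs0
  have h := norm_mean_sub_mean_le W W' hdet
  have hq := norm_qsum_sub_qsum_le W W'
  calc ‖(mean W : Matrix (Fin 2) (Fin 2) ℂ) - (mean W' : Matrix (Fin 2) (Fin 2) ℂ)‖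
        ≤ 2 * (Real.sqrt ((qsum W).det).re)⁻¹ * ‖qsum W - qsum W'‖ := h
    _ ≤ 2 / (Fintype.card ι * (1 - δ ^ 2 / 2)) * ‖qsum W - qsum W'‖ := by
        refine mul_le_mul_of_nonneg_right ?_ (norm_nonneg _)
        rw [div_eq_mul_inv]
        exact mul_le_mul_of_nonneg_left ((inv_le_inv₀ hs0 hlow).2 hs) (by norm_num)
    _ ≤ 2 / (Fintype.card ι * (1 - δ ^ 2 / 2)) * ∑ j, ‖(W j : Matrix (Fin 2) (Fin 2) ℂ) - (W' j : Matrix (Fin 2) (Fin 2) ℂ)‖ :=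
        mul_le_mul_of_nonneg_left hq (div_nonneg (by norm_num) hlow.le)

/-- In particular (`δ ≤ 1 ⇒ 1 − δ²/2 ≥ ½`): `‖mean W − mean W′‖ ≤ (4/n) Σ_j ‖W_j − W′_j‖` — each of the `n` variables enters
the mean with Lipschitz weight at most `4/n`. [folklore] -/
theorem norm_mean_sub_mean_le_four_div [Nonempty ι] (W W' : ι → Matrix.specialUnitaryGroup (Fin 2) ℂ) {δ : ℝ}
    (hW : ∀ j, ‖(W j : Matrix (Fin 2) (Fin 2) ℂ) - 1‖ ≤ δ) (hδ : δ ≤ 1) :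
    ‖(mean W : Matrix (Fin 2) (Fin 2) ℂ) - (mean W' : Matrix (Fin 2) (Fin 2) ℂ)‖ ≤
      4 / Fintype.card ι * ∑ j, ‖(W j : Matrix (Fin 2) (Fin 2) ℂ) - (W' j : Matrix (Fin 2) (Fin 2) ℂ)‖ := by
  have hn : (0 : ℝ) < Fintype.card ι := Nat.cast_pos.2 Fintype.card_pos
  have hδ0 : 0 ≤ δ := (norm_nonneg _).trans (hW (Classical.arbitrary ι))
  have hδ2 : δ ^ 2 ≤ 1 := by nlinarith
  refine (norm_mean_sub_mean_le_of_small W W' hW hδ).trans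
    (mul_le_mul_of_nonneg_right ?_ (Finset.sum_nonneg fun _ _ => norm_nonneg _))
  rw [div_le_div_iff₀ (mul_pos hn (by nlinarith)) hn]
  nlinarith [mul_nonneg hn.le (sub_nonneg.2 hδ2)]

/-! ## 4. (0.8), logarithmic form -/

open MatrixLog

/-- **(0.8), logarithmic form** (series logarithm (21)): on a nonempty family with all `‖W_j − 1‖ ≤ ½`,
`‖log (mean W) − n⁻¹ Σ_j log W_j‖ ≤ (5/2) · n⁻¹ Σ_j ‖W_j − 1‖²`. [cite: Balaban1987RG1, (0.8) p.253] -/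
theorem norm_mlog_mean_sub_le [Nonempty ι] (W : ι → Matrix.specialUnitaryGroup (Fin 2) ℂ)
    (hW : ∀ j, ‖(W j : Matrix (Fin 2) (Fin 2) ℂ) - 1‖ ≤ 1 / 2) :
    ‖mlog (mean W : Matrix (Fin 2) (Fin 2) ℂ) - ((Fintype.card ι : ℂ))⁻¹ • ∑ j, mlog (W j : Matrix (Fin 2) (Fin 2) ℂ)‖ ≤
      5 / 2 * ((Fintype.card ι : ℝ)⁻¹ * ∑ j, ‖(W j : Matrix (Fin 2) (Fin 2) ℂ) - 1‖ ^ 2) := by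
  have hn : (0 : ℝ) < Fintype.card ι := Nat.cast_pos.2 Fintype.card_pos
  have hnc : (Fintype.card ι : ℂ) ≠ 0 := Nat.cast_ne_zero.2 Fintype.card_ne_zero
  -- piece A: the barycentre form
  have hA : ‖(mean W : Matrix (Fin 2) (Fin 2) ℂ) - ((Fintype.card ι : ℂ))⁻¹ • qsum W‖ ≤
      ((Fintype.card ι : ℝ)⁻¹ * ∑ j, ‖(W j : Matrix (Fin 2) (Fin 2) ℂ) - 1‖ ^ 2) / 2 := by
    have h := norm_mean_sub_bary_le W
    have e : (2 * (Fintype.card ι : ℝ))⁻¹ * ∑ j, ‖(W j : Matrix (Fin 2) (Fin 2) ℂ) - 1‖ ^ 2 =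
        ((Fintype.card ι : ℝ)⁻¹ * ∑ j, ‖(W j : Matrix (Fin 2) (Fin 2) ℂ) - 1‖ ^ 2) / 2 := by
      rw [mul_inv]; ring
    linarith
  -- piece B: the remainder of the logarithm at the mean (`‖mean − 1‖ ≤ ½`, `‖mean − 1‖² ≤ S`)
  have hm1 : ‖(mean W : Matrix (Fin 2) (Fin 2) ℂ) - 1‖ ≤ 1 / 2 := norm_mean_sub_one_le_of_forall_le W hW (by norm_num)
  have htr : 0 ≤ ((qsum W).trace).re := by
    rw [trace_qsum_re_eq]
    have hsq : ∀ j, ‖(W j : Matrix (Fin 2) (Fin 2) ℂ) - 1‖ ^ 2 ≤ 2 := fun j =>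
      (pow_le_pow_left₀ (norm_nonneg _) (hW j) 2).trans (by norm_num)
    have : ∑ j, ‖(W j : Matrix (Fin 2) (Fin 2) ℂ) - 1‖ ^ 2 ≤ Fintype.card ι * 2 := by
      calc ∑ j, ‖(W j : Matrix (Fin 2) (Fin 2) ℂ) - 1‖ ^ 2 ≤ ∑ _j : ι, (2 : ℝ) := Finset.sum_le_sum fun j _ => hsq j
        _ = Fintype.card ι * 2 := by rw [Finset.sum_const, Finset.card_univ, nsmul_eq_mul]
    linarith
  have hB : ‖mlog (mean W : Matrix (Fin 2) (Fin 2) ℂ) - ((mean W : Matrix (Fin 2) (Fin 2) ℂ) - 1)‖ ≤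
      (Fintype.card ι : ℝ)⁻¹ * ∑ j, ‖(W j : Matrix (Fin 2) (Fin 2) ℂ) - 1‖ ^ 2 :=
    (norm_mlog_sub_sub_one_le_sq hm1).trans (norm_mean_sub_one_sq_le W htr)
  -- piece C: the remainders at the `W_j`
  have hC : ‖((Fintype.card ι : ℂ))⁻¹ • ∑ j, (mlog (W j : Matrix (Fin 2) (Fin 2) ℂ) - ((W j : Matrix (Fin 2) (Fin 2) ℂ) - 1))‖ ≤
      (Fintype.card ι : ℝ)⁻¹ * ∑ j, ‖(W j : Matrix (Fin 2) (Fin 2) ℂ) - 1‖ ^ 2 := by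
    rw [norm_smul, norm_inv, Complex.norm_natCast]
    refine mul_le_mul_of_nonneg_left ((norm_sum_le _ _).trans (Finset.sum_le_sum fun j _ => ?_)) (by positivity)
    exact norm_mlog_sub_sub_one_le_sq (hW j)
  -- the algebraic identity
  have hc1 : ((Fintype.card ι : ℂ))⁻¹ • ∑ _j : ι, (1 : Matrix (Fin 2) (Fin 2) ℂ) = 1 := by
    rw [Finset.sum_const, Finset.card_univ, ← Nat.cast_smul_eq_nsmul ℂ, smul_smul, inv_mul_cancel₀ hnc, one_smul]
  have key : mlog (mean W : Matrix (Fin 2) (Fin 2) ℂ) - ((Fintype.card ι : ℂ))⁻¹ • ∑ j, mlog (W j : Matrix (Fin 2) (Fin 2) ℂ) =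
      ((mean W : Matrix (Fin 2) (Fin 2) ℂ) - ((Fintype.card ι : ℂ))⁻¹ • qsum W) +
        (mlog (mean W : Matrix (Fin 2) (Fin 2) ℂ) - ((mean W : Matrix (Fin 2) (Fin 2) ℂ) - 1)) -
        ((Fintype.card ι : ℂ))⁻¹ • ∑ j, (mlog (W j : Matrix (Fin 2) (Fin 2) ℂ) - ((W j : Matrix (Fin 2) (Fin 2) ℂ) - 1)) := by
    unfold qsum
    rw [Finset.sum_sub_distrib, Finset.sum_sub_distrib, smul_sub, smul_sub, hc1]
    abel
  rw [key]
  calc ‖((mean W : Matrix (Fin 2) (Fin 2) ℂ) - ((Fintype.card ι : ℂ))⁻¹ • qsum W) +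
        (mlog (mean W : Matrix (Fin 2) (Fin 2) ℂ) - ((mean W : Matrix (Fin 2) (Fin 2) ℂ) - 1)) -
        ((Fintype.card ι : ℂ))⁻¹ • ∑ j, (mlog (W j : Matrix (Fin 2) (Fin 2) ℂ) - ((W j : Matrix (Fin 2) (Fin 2) ℂ) - 1))‖
        ≤ ‖((mean W : Matrix (Fin 2) (Fin 2) ℂ) - ((Fintype.card ι : ℂ))⁻¹ • qsum W) +
            (mlog (mean W : Matrix (Fin 2) (Fin 2) ℂ) - ((mean W : Matrix (Fin 2) (Fin 2) ℂ) - 1))‖ +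
          ‖((Fintype.card ι : ℂ))⁻¹ • ∑ j, (mlog (W j : Matrix (Fin 2) (Fin 2) ℂ) - ((W j : Matrix (Fin 2) (Fin 2) ℂ) - 1))‖ :=
          norm_sub_le _ _
    _ ≤ ‖(mean W : Matrix (Fin 2) (Fin 2) ℂ) - ((Fintype.card ι : ℂ))⁻¹ • qsum W‖ +
          ‖mlog (mean W : Matrix (Fin 2) (Fin 2) ℂ) - ((mean W : Matrix (Fin 2) (Fin 2) ℂ) - 1)‖ +
          ‖((Fintype.card ι : ℂ))⁻¹ • ∑ j, (mlog (W j : Matrix (Fin 2) (Fin 2) ℂ) - ((W j : Matrix (Fin 2) (Fin 2) ℂ) - 1))‖ :=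
          add_le_add (norm_add_le _ _) le_rfl
    _ ≤ _ := by linarith

/-- **(0.8) in the printed variables**: with `A_j := (1/i) log W_j` (so that `W_j = e^{iA_j}`, `MatrixLog.exp_mlog`), on a
nonempty family with all `‖W_j − 1‖ ≤ ½`: `‖(1/i) log (mean W) − n⁻¹ Σ_j A_j‖ ≤ 10 · n⁻¹ Σ_j ‖A_j‖²` (by (27):
`‖W_j − 1‖ ≤ 2‖A_j‖`). [cite: Balaban1987RG1, (0.8) p.253] -/
theorem norm_Iinv_mlog_mean_sub_le [Nonempty ι] (W : ι → Matrix.specialUnitaryGroup (Fin 2) ℂ)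
    (hW : ∀ j, ‖(W j : Matrix (Fin 2) (Fin 2) ℂ) - 1‖ ≤ 1 / 2) :
    ‖(Complex.I⁻¹ : ℂ) • mlog (mean W : Matrix (Fin 2) (Fin 2) ℂ) -
        ((Fintype.card ι : ℂ))⁻¹ • ∑ j, (Complex.I⁻¹ : ℂ) • mlog (W j : Matrix (Fin 2) (Fin 2) ℂ)‖ ≤
      10 * ((Fintype.card ι : ℝ)⁻¹ * ∑ j, ‖(Complex.I⁻¹ : ℂ) • mlog (W j : Matrix (Fin 2) (Fin 2) ℂ)‖ ^ 2) := by
  have hn : (0 : ℝ) < Fintype.card ι := Nat.cast_pos.2 Fintype.card_pos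
  have hI : ‖(Complex.I⁻¹ : ℂ)‖ = 1 := by rw [norm_inv, Complex.norm_I, inv_one]
  have e : (Complex.I⁻¹ : ℂ) • mlog (mean W : Matrix (Fin 2) (Fin 2) ℂ) -
        ((Fintype.card ι : ℂ))⁻¹ • ∑ j, (Complex.I⁻¹ : ℂ) • mlog (W j : Matrix (Fin 2) (Fin 2) ℂ) =
      (Complex.I⁻¹ : ℂ) •
        (mlog (mean W : Matrix (Fin 2) (Fin 2) ℂ) - ((Fintype.card ι : ℂ))⁻¹ • ∑ j, mlog (W j : Matrix (Fin 2) (Fin 2) ℂ)) := by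
    rw [← Finset.smul_sum, smul_comm, smul_sub]
  rw [e, norm_smul, hI, one_mul]
  have hj : ∀ j, ‖(W j : Matrix (Fin 2) (Fin 2) ℂ) - 1‖ ^ 2 ≤
      4 * ‖(Complex.I⁻¹ : ℂ) • mlog (W j : Matrix (Fin 2) (Fin 2) ℂ)‖ ^ 2 := fun j => by
    rw [norm_smul, hI, one_mul]
    have h := norm_sub_one_le_two_mul_norm_mlog (hW j)
    nlinarith [norm_nonneg ((W j : Matrix (Fin 2) (Fin 2) ℂ) - 1), norm_nonneg (mlog (W j : Matrix (Fin 2) (Fin 2) ℂ))]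
  have hsum : ∑ j, ‖(W j : Matrix (Fin 2) (Fin 2) ℂ) - 1‖ ^ 2 ≤
      4 * ∑ j, ‖(Complex.I⁻¹ : ℂ) • mlog (W j : Matrix (Fin 2) (Fin 2) ℂ)‖ ^ 2 := by
    rw [Finset.mul_sum]; exact Finset.sum_le_sum fun j _ => hj j
  refine (norm_mlog_mean_sub_le W hW).trans ?_
  have := mul_le_mul_of_nonneg_left hsum (inv_nonneg.2 hn.le)
  nlinarith

/-- And `W_j = exp (I • A_j)` for `A_j = (1/i) log W_j`, `‖W_j − 1‖ < 1` ("U_j = exp iA_j"). [cite: Balaban1985Averaging, (21) p.21] -/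
theorem exp_I_smul_Iinv_mlog (U : Matrix.specialUnitaryGroup (Fin 2) ℂ) (hU : ‖(U : Matrix (Fin 2) (Fin 2) ℂ) - 1‖ < 1) :
    exp (Complex.I • ((Complex.I⁻¹ : ℂ) • mlog (U : Matrix (Fin 2) (Fin 2) ℂ))) = (U : Matrix (Fin 2) (Fin 2) ℂ) := by
  rw [smul_smul, mul_inv_cancel₀ Complex.I_ne_zero, one_smul, exp_mlog hU]

end SU2Mean

/-! ## 5. The statements for the `LoopAverage` instance `su2Mean` -/

section su2Mean

open MatrixLog

/-- (0.8), barycentre form, for `su2Mean` on `Fin (k+1)`-families: `‖E W − (k+1)⁻¹ Σ_j W_j‖ ≤ (2(k+1))⁻¹ Σ_j (dist1 W_j)²`.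
[cite: Balaban1987RG1, (0.8) p.253] -/
theorem su2Mean_norm_sub_bary_le {k : ℕ} (W : Fin (k+1) → Matrix.specialUnitaryGroup (Fin 2) ℂ) :
    ‖(su2Mean.E W : Matrix (Fin 2) (Fin 2) ℂ) - ((k + 1 : ℂ))⁻¹ • ∑ j, (W j : Matrix (Fin 2) (Fin 2) ℂ)‖ ≤
      (2 * (k + 1 : ℝ))⁻¹ * ∑ j, dist1 (W j) ^ 2 := by
  have h := SU2Mean.norm_mean_sub_bary_le W
  simp only [Fintype.card_fin, Nat.cast_add, Nat.cast_one] at h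
  simpa [SU2Mean.dist1_eq_norm, SU2Mean.qsum] using h

/-- "the average is close to the identity also" for `su2Mean`: `dist1 W_j ≤ δ` for all `j` and `δ² ≤ 2` give
`dist1 (E W) ≤ δ` (in particular on the instance's domain `dist1 < su2Mean.δ = 1`). [cite: Balaban1987RG1, (0.8) p.253] -/
theorem su2Mean_dist1_le {k : ℕ} (W : Fin (k+1) → Matrix.specialUnitaryGroup (Fin 2) ℂ) {δ : ℝ}
    (hW : ∀ j, dist1 (W j) ≤ δ) (hδ : δ ^ 2 ≤ 2) : dist1 (su2Mean.E W) ≤ δ := by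
  rw [SU2Mean.dist1_eq_norm, su2Mean_E]
  exact SU2Mean.norm_mean_sub_one_le_of_forall_le W (fun j => (SU2Mean.dist1_eq_norm (W j)) ▸ hW j) hδ

/-- (0.8), logarithmic form, for `su2Mean`: `dist1 W_j ≤ ½` for all `j` gives
`‖log (E W) − (k+1)⁻¹ Σ_j log W_j‖ ≤ (5/2)(k+1)⁻¹ Σ_j (dist1 W_j)²`. [cite: Balaban1987RG1, (0.8) p.253] -/
theorem su2Mean_mlog_le {k : ℕ} (W : Fin (k+1) → Matrix.specialUnitaryGroup (Fin 2) ℂ) (hW : ∀ j, dist1 (W j) ≤ 1 / 2) :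
    ‖mlog (su2Mean.E W : Matrix (Fin 2) (Fin 2) ℂ) - ((k + 1 : ℂ))⁻¹ • ∑ j, mlog (W j : Matrix (Fin 2) (Fin 2) ℂ)‖ ≤
      5 / 2 * ((k + 1 : ℝ)⁻¹ * ∑ j, dist1 (W j) ^ 2) := by
  have h := SU2Mean.norm_mlog_mean_sub_le W (fun j => (SU2Mean.dist1_eq_norm (W j)) ▸ hW j)
  simp only [Fintype.card_fin, Nat.cast_add, Nat.cast_one] at h
  simpa [SU2Mean.dist1_eq_norm] using h

/-- The per-variable modulus for `su2Mean`: `dist1 W_j ≤ δ ≤ 1` for all `j` gives, for every `W′`,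
`‖E W − E W′‖ ≤ (4/(k+1)) Σ_j ‖W_j − W′_j‖`. [folklore] -/
theorem su2Mean_lipschitz {k : ℕ} (W W' : Fin (k+1) → Matrix.specialUnitaryGroup (Fin 2) ℂ) {δ : ℝ}
    (hW : ∀ j, dist1 (W j) ≤ δ) (hδ : δ ≤ 1) :
    ‖(su2Mean.E W : Matrix (Fin 2) (Fin 2) ℂ) - (su2Mean.E W' : Matrix (Fin 2) (Fin 2) ℂ)‖ ≤
      4 / (k + 1 : ℝ) * ∑ j, ‖(W j : Matrix (Fin 2) (Fin 2) ℂ) - (W' j : Matrix (Fin 2) (Fin 2) ℂ)‖ := by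
  have h := SU2Mean.norm_mean_sub_mean_le_four_div W W' (fun j => (SU2Mean.dist1_eq_norm (W j)) ▸ hW j) hδ
  simp only [Fintype.card_fin, Nat.cast_add, Nat.cast_one] at h
  simpa using h

end su2Mean

end Literature.MathematicalPhysics.QuantumFieldTheory.Balaban1983to89
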